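import Literature.NumberTheory.EllipticCurves.Kato2004.IwasawaCohomologyCoeff
import Literature.NumberTheory.EllipticCurves.SharpFlatPAdicLFunctionCoeffField
import HarnessLib

/-!
# Kato 2004 (Astérisque 295) §12.2 (12.2.1), §12.3 / Thm. 12.4 (2) and §13.8 for the Galois
# representation of a weight-`2` newform `g` WITH `𝒪_λ`-COEFFICIENTS along the cyclotomic
# `ℤ_p`-extension, ANY prime `p` (`p = 2` included): the pinned Iwasawa cohomology
# `𝐇¹_Γ(T_g)` over `Λ_𝒪 = 𝒪⟦X⟧` EXISTS and is finitely generated, torsion free, of rank one —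
# two named facts (D-0014; nothing asserted)

Topic `NumberTheory/EllipticCurves`, sub-directory `Kato2004` (namespace = path). Written by cell
`bsd-stepL`'s definition typer (seat `bsd-stepL-defn-ty1`, g23) as step (2) of the typing of the
cite/fact item **wi-88196** of cell `bsd-wall` ("fact: Kato 2004 §12 Thm 12.4/12.5 — p-adic zeta
elements + explicit reciprocity for a weight-2 newform with `𝒪_λ`-coefficients, `p = 2` allowed";
consumer: crux stmt-BirchSwinnertonDyer-26074 `ResidualThetaCountLowerPureAtTwo`, registered skeleton
`Cruxes/ResidualThetaCountLowerPureAtTwo/Lines/bt26_lambda.lean`, stub `stub_cmLambdaLower` (S2), LEAD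
`bsd-wall-rtt-p2`; director-bsd PUB-CM (P5)).  Step (1) is the generic pinned interface
`Kato2004.IwasawaH1DataCoeff (T : GaloisRep ℚ A M) p κ γ` over `A⟦X⟧` (file
`Kato2004/IwasawaCohomologyCoeff.lean`).  THIS FILE states, on that pin, the two NON-VACUOUS clauses of
Kato's Chapter III for the lattice `T_ρ = 𝒪²` of an integral `p`-adic model
`ρ : Γ_ℚ → GL₂(𝒪)` of `g` along an embedding `ι : K_g → ℚ̄_p` (`𝒪 = padicCoeffIntegers (Set.range ι)`,
the integers of `F_λ = ℚ_p(ι K_g)`; `Λ_𝒪 = IwasawaAlgebraO (Set.range ι) = 𝒪⟦X⟧`, the tree's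
coefficient Iwasawa algebra of `SharpFlatPAdicLFunctionCoeffField.lean`, DEFINITIONALLY the
`PowerSeries 𝒪` of the generic pin):
* `nonempty_iwasawaH1DataCoeff_newform` — (12.2.1) with §13.8 (p. 228): the datum exists;
* `thm12_4_newform` — (12.2.1) + Thm. 12.4 (2): `𝐇¹_Γ(T_ρ)` is a finitely generated, torsion free
  `Λ_𝒪`-module of rank `1`.
The ELLIPTIC-CURVE versions of exactly these two facts are the tree's `Kato2004.nonempty_iwasawaH1Data`
and `Kato2004.thm12_4` (`T = T_pW`, `𝒪 = ℤ_p`), whose module docstring carries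
`-- TODO(general form): … arbitrary newforms f of weight k ≥ 2 with coefficients, arbitrary lattices T`;
this file is the weight-`2`, `Γ₀(M)`, `𝒪_λ`-coefficient case of that general form (the case the
consumer needs), binder for binder in the consumer's currency.  HONEST FRAMING: two named facts
(`def … : Prop`, nothing asserted, no `_holds`; net debt +2; statement-only: consumers open them with
`obtain ⟨I⟩ := hne …` / `obtain ⟨hfin, htf, hrk⟩ := h … I`); NOT here: Thm. 12.4 (1) (`𝐇²` — no object in the tree; it can only enter a
PACKAGE, cf. `Kato2004/DivisibilityInputs.lean`, `Kato2004/IwasawaH2Descent.lean`), Thm. 12.4 (3) and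
Thm. 12.5 (4) (printed under `p ≠ 2`), Thm. 12.5 (1)–(3) / 12.6 (zeta elements: their VALUE clause needs
the dual exponential / `S(f)` / period vocabulary for `V_{F_λ}(g)`, absent from the tree; their
value-free clauses are package material), Burungale–Tian 2026 Thm. 2.6 (item wi-88195; package
material for the same reason).  BSD is not advanced by this file; no statement about any curve.

## The printed statements (K. Kato, Astérisque 295 (2004); `[p. N]` = printed page; store key
`paper:doi-10-24033-ast-639`, PDF page `N − 115`; re-read by this seat 2026-08-28, files p0105–p0107,
p0125–p0126)

* **§12.2 [p. 220]** "Let `T` be a finitely generated `ℤ_p`-module endowed with a continuous action of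
  `Gal(ℚ̄/ℚ)` which is unramified at almost all prime numbers. We denote for `q ∈ ℤ`
  `𝐇^q(T) = lim←_n H^q(ℤ[ζ_{p^n}, 1/p], T)` … the inverse limit is taken with respect to trace maps.
  The following are known: **(12.2.1)** `𝐇^q(T) = 0` if `q ≠ 1, 2` and `𝐇¹(T)` and `𝐇²(T)` are
  finitely generated `ℤ_p[[G_∞]]`-modules."
* **§12.3 [p. 221]** "Let `k, N` and `f = Σ aₙqⁿ` be as in the beginning of Chap. III, and let
  `F = ℚ(aₙ ; n ≥ 1)` … Let `λ` be a place of `F` lying over `p`, `F_λ` the local field of `F` at `λ`,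
  `O_λ` the valuation ring of `F_λ` … and let `Λ = O_λ[[G_∞]]`. Consider the two dimensional
  representation `V_{F_λ}(f)` of `Gal(ℚ̄/ℚ)` over `F_λ` associated to `f` (8.3). … **Theorem 12.4.** —
  Take any `Gal(ℚ̄/ℚ)`-stable `O_λ`-lattice `T` of `V_{F_λ}`. Then: (1) `𝐇²(T)` is a torsion
  `Λ`-module. (2) `𝐇¹(T)` is a torsion free `Λ`-module, and `𝐇¹(T) ⊗ ℚ = 𝐇¹(V_{F_λ}(f))` is a free
  `Λ ⊗ ℚ`-module of rank `1`. (3) If `p ≠ 2` and if `T/m_λT` is irreducible as a two dimensional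
  representation of `Gal(ℚ̄/ℚ)` over `O_λ/m_λ`, `𝐇¹(T)` is a free `Λ`-module of rank `1`."  Proofs:
  §13.8 [pp. 227–229] for `f` without complex multiplication ((1) from (12.8.2), Thm. 13.4 (1), 13.7;
  (2) from (12.2.2) and Shapiro; (3) a regular sequence) and §15 for CM forms (15.14–15.15) — NO
  hypothesis on `p` (any prime, `p ∣ N` allowed) or on `f` (CM or not) in (1)(2).
* **§13.8 [p. 228]** "`H^q(ℤ[ζ_{p^n}, 1/p], T) ≅ H^q(ℤ[1/p], T ⊗_{O_λ} O_λ[G_n])` … Hence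
  `𝐇^q(T) = lim←_n H^q(ℤ[1/p], T ⊗ O_λ[G_n])`" (the `Λ`-structure through the second factor).
* **§14.10 (14.10.1) [p. 240]** "`V_{F_λ}(f*)` is isomorphic to `Hom_{F_λ}(V_{F_λ}(f), F_λ)(1 − k)` …
  Hence for `r ∈ ℤ` and for a `Gal(ℚ̄/ℚ)`-stable lattice `T` of `V_{F_λ}(f)(r)`, `T*(1)` is isomorphic
  to a `Gal(ℚ̄/ℚ)`-stable `O_λ`-lattice of `V_{F_λ}(f*)(k − r)`", and (proof of Prop. 14.11, [p. 241])
  "by (14.10.3), the action of `1 − a_ℓ Fr_ℓ + ε(ℓ)ℓ^{k−1}Fr_ℓ²` is zero on `V_{F_λ}(f)`".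
* Restated in refereed print, in the `Λ ⊗ ℚ` form, for "`f ∈ S_k(Γ₁(N))` an elliptic newform and `p`
  a prime" with the frame written out AT `p = 2` (`Δ ≅ ℤ/2`): A. Burungale, Y. Tian, Ann. of Math.
  203 (2026), §2.2.2–§2.2.3 and Thm. 2.3 (= [Kato, Thm. 12.4]) [store text
  `paper:burungale2025-rank-zero-p-converse-theorem-gross-zagier` p0004].

## READING (how the Lean binders are the printed objects; every sentence checkable)

(R1) **The lattice.**  The consumer's `ρ : FramedGaloisRep ℚ 𝒪 2` is bound (verbatim the binder of
`stub_thetaDatum` / `stub_cmLambdaLower`, with `2 ↦ p`) by: unramified at every prime `ℓ ∤ pM` with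
every ARITHMETIC Frobenius there of characteristic polynomial `X² − ι(a_ℓ(g))X + ℓ` (the tree's
`FramedGaloisRep.HasFrobCharpolyAt`, arithmetic convention, as in `IsIntegralPadicModel` and EPW §3.1).
By Kato's (14.10.3) the GEOMETRIC Frobenius has this polynomial on `V_{F_λ}(g)`, so (Chebotarev +
Brauer–Nesbitt, `g` of trivial character so `g* = g`) `T_ρ ⊗ F_λ ≅ V_{F_λ}(g)^∨ ≅ V_{F_λ}(g)(1)`
((14.10.1) with `k = 2`): `T_ρ` is a `Gal(ℚ̄/ℚ)`-stable `O_λ`-lattice of `V_{F_λ}(g)(1)` — exactly the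
position of `T_pE ≅ V_{ℤ_p}(f_E)(1)` in the tree's `thm12_4`, whose reading we repeat: over the full
tower `ℚ(ζ_{p^∞}) ⊇ μ_{p^∞}` the Tate twist is a (semilinear, for the twisting automorphism of `Λ`)
automorphism of Iwasawa cohomology, `𝐇^q(T(1)) ≅ 𝐇^q(T) ⊗ ℤ_p(1)`, which preserves "finitely
generated", "torsion free" and "`⊗ ℚ` free of rank one"; and Thm. 12.4 holds for every lattice.
(R2) **The component.**  The pin is along the cyclotomic `ℤ_p`-extension `ℚ_∞/ℚ` (`κ.IsCyclotomic`):
`𝐇¹_Γ(T) = lim←_n H¹(ℤ_n[1/p], T)`, a module over `O_λ⟦X⟧`.  For `p` odd this is the `Δ`-trivial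
component of Kato's `𝐇¹(T)` over `Λ = ∏_j O_λ[[G_∞]]_j` ((12.1.2); restriction–corestriction, `#Δ`
prime to `p`), and each clause of (12.2.1)/Thm. 12.4 (2) passes to a direct factor.  AT `p = 2`
(`Δ = {1, c}`, no idempotent in `Λ`; (12.1.1)–(12.1.2) [p. 219] "the cokernel is killed by `2`") the
same conclusions hold by the argument (β₂.1)–(β₂.4) recorded in the module docstring of
`Kato2004/IwasawaCohomology.lean` (D-audit `bsd-2adic-audit-2` GEN 10, sheet
`pub/bsd-2adic/audit/D-AUDIT-h12at2-Kato04-Thm124-Gamma-tower-at-2.md`), whose only input about `T` is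
the vanishing `T^{Gal(ℚ̄/K_n)} = 0`, `K_n = ℚ(ζ_{2^{n+2}})`, used for the injectivity of restriction
`H¹(ℚ_n, T) → H¹(K_n, T)`; for `T = T_ρ ⊂ V_{F_λ}(g)(1)` this holds for every number field in place of
`K_n` by purity ((14.10.5): the Frobenius eigenvalues on `V_{F_λ}(g)(1)` are Weil numbers of weight
`−1 ≠ 0`, so no open subgroup of `Gal(ℚ̄/ℚ)` fixes a non-zero vector).  Hence, for every prime `p`:
`𝐇¹_Γ(T_ρ)` is finitely generated over `O_λ⟦X⟧` ((12.2.1): `Λ` is finite over the noetherian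
`O_λ⟦X⟧`), torsion free (Thm. 12.4 (2): a non-zero element of the domain `O_λ⟦X⟧` is a non-zero-divisor
of `Λ`), and `𝐇¹_Γ(T_ρ) ⊗ ℚ` is free of rank one over `O_λ⟦X⟧ ⊗ ℚ` (Thm. 12.4 (2) on the
`(1 + c)/2`-component after `⊗ ℚ`), so `Module.rank_{O_λ⟦X⟧} 𝐇¹_Γ(T_ρ) = 1`.  A SPECIAL CASE of print,
clause by clause, never stronger; `-- TODO(general form)` below records the rest.
(R3) **Weight and level.**  Kato's `f` is any normalised newform of weight `k ≥ 2` and level `N`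
(beginning of Chap. III); here `g ∈ S₂(Γ₀(M))` with `IsNewform0 g` (trivial character, weight `2` —
the consumer's case; the tree's `embCoeff` is weight-`2`).

## References

* K. Kato, *p-adic Hodge theory and values of zeta functions of modular forms*, Astérisque 295 (2004)
  117–290: §12.1 (12.1.1)–(12.1.2) (p. 219), §12.2 (12.2.1) (p. 220), §12.3 and Thm. 12.4 (p. 221),
  §13.8 (pp. 227–229), §14.10 (14.10.1), (14.10.3), (14.10.5) (pp. 240–241), §15.14–15.15.
  [Kato2004Asterisque]
* A. Burungale, Y. Tian, *A rank zero p-converse to a theorem of Gross–Zagier, Kolyvagin and Rubin*,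
  Ann. of Math. 203 (2026), §2.2.2–2.2.3, Thm. 2.3 (p. 4). [BurungaleTian2026]
* M. Emerton, R. Pollack, T. Weston, Invent. Math. 163 (2006), §3.1 (the integral model `ρ_f : G_ℚ →
  GL₂(𝒪)` characterised by arithmetic Frobenius polynomials). [EmertonPollackWeston2006]
* Tree: `Kato2004/IwasawaCohomologyCoeff.lean` (the pin), `Kato2004/IwasawaCohomology.lean` (the
  `T_pW` facts and the `p = 2` reading), `SharpFlatPAdicLFunctionCoeffField.lean` (`IwasawaAlgebraO`,
  `embCoeff`), `NewformPadicIntegralModel.lean` (`padicCoeffIntegers`, `IsIntegralPadicModel` — the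
  same Frobenius clause over the larger coefficient set `range ι ∪ {υ}`; not reused because the
  consumer's `𝒪` is `padicCoeffIntegers (Set.range ι)` and the two subrings are different TYPES),
  `Summits/…/Cruxes/ResidualThetaCountLowerPureAtTwo/Lines/bt26_lambda.lean` (the consumer binders).
-/

noncomputable section

open scoped NumberField
open Field IsDedekindDomain CongruenceSubgroup
open Literature.NumberTheory.GaloisRepresentations
open Literature.NumberTheory.EllipticCurves Literature.NumberTheory.EllipticCurves.ModularForms
open Literature.NumberTheory.EllipticCurves.Kato2004

namespace Literature.NumberTheory.EllipticCurves.Kato2004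

/-! ## The named facts: existence of the datum ((12.2.1) + §13.8) and Thm. 12.4 (2) with (12.2.1),
for the lattice of an integral `p`-adic model of a weight-`2` newform with `𝒪_λ`-coefficients -/

/-- **Kato 2004, §12.2 (12.2.1) with §13.8 (p. 228), for `T = T_ρ` the lattice of an integral `p`-adic
model `ρ : Γ_ℚ → GL₂(𝒪)` of a weight-`2` newform `g` along `ι : K_g → ℚ̄_p`
(`𝒪 = padicCoeffIntegers (Set.range ι)`): the Iwasawa cohomology `𝐇¹_Γ(T_ρ) = lim←_n H¹(ℤ_n[1/p], T_ρ)`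
along the cyclotomic `ℤ_p`-extension exists as an `𝒪⟦X⟧`-module with `X = conj_γ − 1`** — i.e.
`IwasawaH1DataCoeff ρ.toGaloisRep p κ γ` is inhabited, for EVERY prime `p` (`p = 2` and `p ∣ M`
included), every `g ∈ S₂(Γ₀(M))` with `IsNewform0 g`, every `ι`, every `ρ` unramified with arithmetic
Frobenius polynomial `X² − ι(a_ℓ(g))X + ℓ` at the primes `ℓ ∤ pM` (the binder of the consumer's
`stub_thetaDatum`, READING (R1)), every cyclotomic `κ` with topological generator `γ`.  Printed:
"(12.2.1) … `𝐇¹(T)` and `𝐇²(T)` are finitely generated `ℤ_p[[G_∞]]`-modules" [p. 220] for "`T` … a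
finitely generated `ℤ_p`-module endowed with a continuous action of `Gal(ℚ̄/ℚ)` which is unramified at
almost all prime numbers", and "`𝐇^q(T) = lim←_n H^q(ℤ[1/p], T ⊗_{O_λ} O_λ[G_n])`" [p. 228] (the
`O_λ[[G_∞]]`-structure through the second factor); the `ℤ_p`-extension / `p = 2` passage is READING
(R2).  The `𝒪_λ`-coefficient twin of `Kato2004.nonempty_iwasawaH1Data`; a CONSTRUCTION fact
(continuity of the `Γ`-action and `p`-adic completeness of the levels `H¹(ℤ_n[1/p], T_ρ)`), no
arithmetic content.  Named fact; nothing asserted.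
-- TODO(general form): any finitely generated `ℤ_p`-module `T` with continuous `Gal(ℚ̄/ℚ)`-action
-- unramified almost everywhere and commuting `A`-structure (Kato §12.2 verbatim); weight `k ≥ 2`,
-- level `Γ₁(N)`.
[cite: Kato2004Asterisque, §12.2 (12.2.1) (p. 220) and §13.8 (p. 228)] -/
def nonempty_iwasawaH1DataCoeff_newform : Prop :=
  ∀ (p : ℕ) [Fact p.Prime] (M : ℕ) [NeZero M] (g : CuspForm (Gamma0 M) 2)
    (ι : coeffField g →+* PadicAlgCl p)
    (ρ : FramedGaloisRep ℚ (padicCoeffIntegers (Set.range ι)) 2)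
    (κ : ZpExtension ℚ p) (γ : absoluteGaloisGroup ℚ),
    IsNewform0 g →
    (∀ v : HeightOneSpectrum (𝓞 ℚ), ¬ Rat.HeightOneSpectrum.natGenerator v ∣ p * M →
      ρ.IsUnramifiedAt v ∧
        ∃ P : Polynomial (padicCoeffIntegers (Set.range ι)),
          P.map (padicCoeffIntegers (Set.range ι)).subtype =
              Polynomial.X ^ 2
                - Polynomial.C (embCoeff g ι (Rat.HeightOneSpectrum.natGenerator v)) * Polynomial.X
                + Polynomial.C ((Rat.HeightOneSpectrum.natGenerator v : ℕ) : PadicAlgCl p) ∧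
            ρ.HasFrobCharpolyAt v P) →
    κ.IsCyclotomic → κ.IsTopGenerator γ →
      Nonempty (IwasawaH1DataCoeff ρ.toGaloisRep p κ γ)

/-- **Kato 2004, (12.2.1) + Thm. 12.4 (2), for `T = T_ρ` the lattice of an integral `p`-adic model
`ρ : Γ_ℚ → GL₂(𝒪)` of a weight-`2` newform `g` along `ι` (a `Gal(ℚ̄/ℚ)`-stable `O_λ`-lattice of
`V_{F_λ}(g)(1)`, READING (R1)), on the pinned `𝐇¹_Γ(T_ρ)` over `Λ_𝒪 = IwasawaAlgebraO (Set.range ι)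
= 𝒪⟦X⟧` along the cyclotomic `ℤ_p`-extension (READING (R2); a special case of print, clause by
clause).**  For EVERY prime `p` (`p = 2`, `p ∣ M` included), every `g ∈ S₂(Γ₀(M))` with `IsNewform0 g`,
every `ι`, every such `ρ`, every cyclotomic `κ` with topological generator `γ` and every datum
`I : IwasawaH1DataCoeff ρ.toGaloisRep p κ γ`:
* (12.2.1) `I.H` is a finitely generated `Λ_𝒪`-module ("`𝐇¹(T)` and `𝐇²(T)` are finitely generated
  `ℤ_p[[G_∞]]`-modules", and `Λ = O_λ[[G_∞]]` is finite over `O_λ⟦X⟧`);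
* Thm. 12.4 (2): `I.H` is torsion free ("`𝐇¹(T)` is a torsion free `Λ`-module") of `Λ_𝒪`-rank `1`
  ("`𝐇¹(T) ⊗ ℚ = 𝐇¹(V_{F_λ}(f))` is a free `Λ ⊗ ℚ`-module of rank `1`", on the component of `ℚ_∞`).
NOT here: Thm. 12.4 (1) (`𝐇²(T)` torsion — no object; package material) and Thm. 12.4 (3) (printed
under `p ≠ 2` and `T/m_λT` irreducible).  The `𝒪_λ`-coefficient twin of `Kato2004.thm12_4` (clauses
(12.2.1) and (2)); it supplies the binders `Module.Finite`, `Module.IsTorsionFree`, `Module.rank = 1`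
of the consumer's `𝒪`-Herbrand / `λ`-invariant algebra (`Summits/…/Theorems/ResidualThetaTransportAtTwoLambdaLowerBoundO*.lean`)
for `𝐇¹_Γ(T_g)` and its quotient by the zeta line.  Named fact; nothing asserted; no `_holds` expected
soon (the proof is §13 / §15 of Kato).
-- TODO(general form): weight `k ≥ 2`, level `Γ₁(N)` with character, arbitrary lattices `T` of
-- `V_{F_λ}(f)(r)`; the full `O_λ[[G_∞]]`-module (all `Δ`-components); clause (3) for `p ≠ 2`.
[cite: Kato2004Asterisque, Thm. 12.4 (2) (p. 221) and §12.2 (12.2.1) (p. 220); §13.8 (pp. 227–229), §14.10 (pp. 240–241)] -/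
def thm12_4_newform : Prop :=
  ∀ (p : ℕ) [Fact p.Prime] (M : ℕ) [NeZero M] (g : CuspForm (Gamma0 M) 2)
    (ι : coeffField g →+* PadicAlgCl p)
    (ρ : FramedGaloisRep ℚ (padicCoeffIntegers (Set.range ι)) 2)
    (κ : ZpExtension ℚ p) (γ : absoluteGaloisGroup ℚ),
    IsNewform0 g →
    (∀ v : HeightOneSpectrum (𝓞 ℚ), ¬ Rat.HeightOneSpectrum.natGenerator v ∣ p * M →
      ρ.IsUnramifiedAt v ∧
        ∃ P : Polynomial (padicCoeffIntegers (Set.range ι)),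
          P.map (padicCoeffIntegers (Set.range ι)).subtype =
              Polynomial.X ^ 2
                - Polynomial.C (embCoeff g ι (Rat.HeightOneSpectrum.natGenerator v)) * Polynomial.X
                + Polynomial.C ((Rat.HeightOneSpectrum.natGenerator v : ℕ) : PadicAlgCl p) ∧
            ρ.HasFrobCharpolyAt v P) →
    κ.IsCyclotomic → κ.IsTopGenerator γ →
      ∀ I : IwasawaH1DataCoeff ρ.toGaloisRep p κ γ,
        Module.Finite (IwasawaAlgebraO (Set.range ι)) I.H ∧
          Module.IsTorsionFree (IwasawaAlgebraO (Set.range ι)) I.H ∧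
            Module.rank (IwasawaAlgebraO (Set.range ι)) I.H = 1

end Literature.NumberTheory.EllipticCurves.Kato2004

end
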